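import Summits.CriticalPhenomena.Ising3DConformalLimit.Theses.PrecisionLaplacian
import Summits.CriticalPhenomena.Ising3DConformalLimit.Theses.BernsteinTemperature
import Summits.CriticalPhenomena.Ising3DConformalLimit.Theses.PrimaryAtInfinity
import Summits.CriticalPhenomena.Ising3DConformalLimit.Theses.PositivityBegetsConformality
import Summits.CriticalPhenomena.Ising3DConformalLimit.Theses.MarkovRigidity
import Summits.CriticalPhenomena.Ising3DConformalLimit.Theorems.MoebiusLimitOfTwoPointLaw.Negative.GroupLemmaNeedsTranslation
import Summits.CriticalPhenomena.Ising3DConformalLimit.Theorems.MoebiusLimitOfTwoPointLaw.Negative.CanonicalForm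
import Summits.CriticalPhenomena.Ising3DConformalLimit.Theorems.MoebiusLimitOfTwoPointLaw.Negative.TwoPointConvergence
import Summits.CriticalPhenomena.Ising3DConformalLimit.Theorems.MoebiusLimitOfTwoPointLaw.Negative.EvenReductionSharp
import Literature.Probability.LatticeModels.CriticalTwoPointLawDimension
import Summits.CriticalPhenomena.Ising3DConformalLimit.Theorems.PrecisionLaplacianMoebiusLimitOfTwoPointLawInversionBegetsRotations
import Summits.CriticalPhenomena.Ising3DConformalLimit.Theorems.PrecisionLaplacianMoebiusLimitOfTwoPointLawDensityOfLawReversal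
import Summits.CriticalPhenomena.Ising3DConformalLimit.Theorems.PrecisionLaplacianMoebiusLimitOfTwoPointLawTwoShellGlue

/-!
# Line `two-shell-exchange-markov` for crux `MoebiusLimitOfTwoPointLaw` (stmt-CriticalPhenomena-4801)

Crux (BY NAME): `Theses.PrecisionLaplacian.MoebiusLimitOfTwoPointLaw`
(= `Theses.BernsteinTemperature.MoebiusLimitOfTwoPointLaw`, same term; routes PrecisionLaplacian r5 and
BernsteinTemperature r5): `P → Q` with `P` = item 0634 (isotropic pure power law
`⟨σ₀σ_x⟩_{β_c}‖x‖₂^{2Δ} → c > 0` cofinitely on `ℤ³`) and `Q` = item 1344 (a non-degenerate Möbius-covariant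
pointwise scaling limit `(ρ, Δ', S)` of `criticalCorr 3`).

Skeleton (crux-plan seat `planner-cruxplan-stmt-CriticalPhenomena-4801-two-shell-exchange-m-0`, 2026-08-16) of
idea card `Ideas/two-shell-exchange-markov.md` (ideator 2; triage r1: fail / pass / pass) with the panel's
sharpenings built in:

* (r1-2) P3 `TwoPointIdentification` is not a stub: it is PROVED here (`twoPoint_of_limit`) from the landed
  `Negative/CanonicalForm` + `Negative/TwoPointConvergence`; so is scale covariance of every regular limit under
  `P` (`isScaleCovariant_of_limit`, from `Negative/EvenReductionSharp` — "dilations are free"), so the sphere chain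
  is STATIONARY honestly, not by assumption.
* (r1-1/r1-2/r1-3 "merge with annulus; K2 ≥ MarkovRigidity 11236") the Markov input is no longer hidden inside a
  correlation-level lift: the field law `μ` of the limit enters through the EXISTING support item
  stmt-CriticalPhenomena-11245 `MarkovRigidity.FieldRealisation` and its germ-Markov property across spheres
  through the EXISTING crux stmt-CriticalPhenomena-11236 `MarkovRigidity.MarkovInheritance`, both BY NAME (shared
  staffing, nothing re-filed); what this line adds on top is exactly two named stubs.
* (r1-3) K1 is stated at the level the reversibility theorem consumes — symmetry of the TWO-TIME LAW of the
  sphere chain = exchangeability of the Weyl-rescaled traces on `S_a ∪ S_b`, whose moment form is the full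
  hierarchy `E_{k,m}` = membership in the landed set `Negative.twoShellExchange Δ` (all `n`, all markings, all
  radii; about every centre by translation invariance) — for REGULAR limits under `P` only, with the weight `Δ`
  pinned to the two-point exponent (`twoPoint_of_limit`), never a free parameter.
* (Disproof §3b `not_groupLemmaWithoutTranslation`) the group half keeps translation invariance: `O(3)` is OUTPUT
  of the existing support item stmt-CriticalPhenomena-4675 `PositivityBegetsConformality.InversionBegetsRotations`
  (translations + unit inversion ⇒ rotations), BY NAME; dilations come from `P` (above), the unit inversion from
  `ι₁ ∈ {ι_λ}` (`isInversionCovariant_of_mem`).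

THE LINE. Under `P` with witness `(Δ, c)`, take the regular translation-invariant limit `(ρ, S)` of
stmt-CriticalPhenomena-5355 (`PrimaryAtInfinity.ExistsRegularLimit`, shared, BY NAME). Proved here: `S₂ = c'‖a−b‖^{-2Δ}`
with the SAME `Δ` (`twoPoint_of_limit`) and `IsScaleCovariant Δ S` (`isScaleCovariant_of_limit`). Item 11245 realises
`S` as the moment densities of a law `μ` on `𝒮'(ℝ³)` with scale-covariant, translation-invariant law; item 11236 makes
`μ` germ-Markov across every sphere. Then:
* `stub_twoTimeSymmetry` (K1, open, HARDEST): `S ∈ twoShellExchange Δ` — the two-time law of the stationary sphere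
  chain `t ↦ (e^{Δt}·trace of the field on S_{e^t})` is symmetric.
* `stub_traceReversibility` (K2, open, the lever): for the germ-Markov law `μ` with moment densities `S`,
  two-time symmetry of the trace moments lifts to REVERSIBILITY of the sphere chain, i.e. `S ∈ sphereInversionCovariant Δ`
  (covariance under every origin-centred sphere inversion `ι_λ`, the time reversals of the chain).
* kinematics (proved): `ι₁`-covariance (`isInversionCovariant_of_mem`), rotations (item 4675), Möbius =
  ⟨translations, rotations⟩ + dilations + inversion: `Q` with `(ρ, Δ, S)`.
`MoebiusLimitOfTwoPointLaw_of : ExistsRegularLimit → FieldRealisation → MarkovInheritance →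
MoebiusLimitOfTwoPointLaw` applies the sorry-free certificate `cruxBody_of_statements` (stub STATEMENTS as hypotheses,
conclusion = the crux's definiens) to the three registered stubs; the only `sorry`s in the closure sit inside the stubs.

LEAD STATUS (cycles 1–2, 2026-08-16): A0 `stub_inversionBegetsRotations` CLOSED (p86170,
`Theorems/PrecisionLaplacianMoebiusLimitOfTwoPointLawInversionBegetsRotations.lean`; = item 4675 proved); glue +
assembly landed as registered sub-goal `stub_moebiusOfReversibleLimits`
(`Theorems/PrecisionLaplacianMoebiusLimitOfTwoPointLawTwoShellGlue.lean`, p89802): crux ⇐ item 5355 ∧ [every regular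
limit under `P` is `ι_λ`-covariant]; K1/K2 free parts landed (p89752, p89807). K2 RESHAPED as K2b ∘ K2a: K2b
`stub_densityOfLawReversal` CLOSED (p92499, helper p91630), K2a `stub_lawReversal` = law-level reversal principle (OPEN
core); K1 `stub_twoTimeSymmetry` STUCK at its core (E_{k,m}, k,m ≥ 1, k+m even ≥ 4). Crux reduced, kernel-checked, to
EXISTENCE + INVERSION (`moebiusLimitOfTwoPointLaw_iff_existence_and_inversion`, `…ExistenceAndInversion.lean`): O(3)
is output. Final assembly `moebiusLimitOfTwoPointLaw_of_existsRegularLimit_of_lawReversal` (`…AssemblyLaw.lean`):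
4801 ⇐ item 5355 ∧ [law-level reversibility of every regular limit] — the two irreducible halves.
FINAL SHAPE (cycle 3): `MoebiusLimitOfTwoPointLaw_of (hE : ExistsRegularLimit)` composes the single open stub L
`stub_lawLevelReversal` (engine-agnostic law-level `ι_λ`-reversibility of regular limits; the statement to PROMOTE) with
the landed K2b and glue; the card's Markov decomposition survives as `MoebiusLimitOfTwoPointLaw_of_markov` (stubs K1, K2a).
Lead verdict: promote-stub `stub_lawLevelReversal`.

LEAD RESHAPE (prover-line-stmt-CriticalPhenomena-4801-0, cycle 1, 2026-08-16): the group lemma — item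
stmt-CriticalPhenomena-4675 `PositivityBegetsConformality.InversionBegetsRotations`, provable now and unclaimed — is
no longer an imported hypothesis but the third registered stub `stub_inversionBegetsRotations` (BY NAME), so that
obligation (b) `O(3)` is discharged inside the line; stubs are now K1 `stub_twoTimeSymmetry` (lead), K2
`stub_traceReversibility`, A0 `stub_inversionBegetsRotations`.

Disproof.lean (cdisprove cycle 2 v12, verdict "resists": `¬crux ↔ P ∧ ¬Q`) honoured:
* `cruxWithoutPosC_iff` (`0 < c` load-bearing) — `0 < c` is used: `twoPoint_of_limit` / `isScaleCovariant_of_limit` /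
  `twoPointLaw_exponent_pos` all consume `hc`; no stub survives with `c = 0`.
* `not_modelBlindCrux` / barrier `TwoPointLawNotMoebius` (model-blind upgrade false) — both stubs quantify over limits
  OF `criticalCorr 3` and K2 consumes the germ-Markov law of the n.n. Gibbs field (items 11245/11236): the line uses
  Ising structure at `n ≥ 4`, exactly where §2 says it must ("H = DLR/Markov structure, used at stub_traceReversibility").
* §2b RP-descendant witness (weight `≥ 5/2`, functional of a Markov field, not Markov for its OWN germ) — K2 asks
  Markov for the observed field's own germ σ-algebras (11236 verbatim) and the weight is the two-point `Δ ∈ [1/2,1]`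
  (`exponent_window`); the witness satisfies neither.
* `not_groupLemmaWithoutTranslation` (§3b) — translations kept (5355 supplies them; 4675 consumes them).
* §3a `kinematicNecessity` / `sphereInversionGivesExchange` / `baseCaseFromTwoPointLaw` (landed as
  `Negative.mem_sphereInversionCovariant_of_scale_of_inversion` / `mem_twoShellExchange_of_mem_sphereInversionCovariant` /
  `twoPoint_exchange_of_twoPointLaw`) — re-used below (`twoShellExchange_of_moebius`: K1's conclusion is NECESSARY for
  `Q`, so K1 is a sub-target, not a foreign bet; `E_{1,1}` holds outright).
* §3c (paper + `output_rank_n4.txt`): at `n = 4`, `E_{2,2}` about all centres + similarities + continuity already give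
  inversion covariance of `S₄`; at generic `n ≥ 6` the hierarchy is silent — recorded in the stub docstrings: K1's
  first open member is `E_{2,2}` (weight-free, lattice-exact for axis patterns, MC job j006843), K2 carries `n ≥ 6`.
* `crux_iff_even_sharper` — obligations (a) full-filter limits = item 5355 (imported), (b) `O(3)` = item 4675 from (c),
  (c) unit inversion = K1 + K2; translations/dilations free (used as such).
No `_false_without_` theorem names exist in Disproof.lean; no landed `Negative/*` lemma refutes an instance of either
stub (the Negative files are imported here, so a clash would not elaborate). `ledger negatives --problem
CriticalPhenomena`: nothing in this sub-problem.
-/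

noncomputable section

namespace Summit.CriticalPhenomena.Ising3DConformalLimit.Cruxes.MoebiusLimitOfTwoPointLaw.TwoShellExchangeMarkov

open Literature.Probability.LatticeModels Filter Topology MeasureTheory
open Literature.Barriers.CriticalPhenomena.ScaleNotMoebius (twoPt injective_fin_two_iff)
open Summit.CriticalPhenomena.Ising3DConformalLimit.Theorems.MoebiusLimitOfTwoPointLaw.Negative
  (sphereInversionCovariant twoShellExchange sphereInversion_eq_smul_inversion
   mem_sphereInversionCovariant_of_scale_of_inversion mem_twoShellExchange_of_mem_sphereInversionCovariant
   twoPoint_exchange_of_twoPointLaw tendsto_rho_sq_mul_rpow tendsto_canonical_ratio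
   hasPointwiseScalingLimit_of_ratio_tendsto rescaledCorrelator_change
   tendstoLocallyUniformlyOn_arity_two_of_twoPointLaw scaleCovariant_of_canonical_limit)

set_option linter.unusedVariables false

/-! ## Objects of the line -/

/-- Points of `ℝ³`. -/
abbrev E3 : Type := EuclideanSpace ℝ (Fin 3)

/-- Field configurations `𝒮'(ℝ³)` (tempered distributions), the carrier of the limit LAW. -/
abbrev Cfg : Type := Literature.MathematicalPhysics.QuantumLattice.FieldConfig (EuclideanSpace ℝ (Fin 3))

/-- `μ` is a MOMENT FIELD of the family `S` with scaling dimension `Δ`: a probability law on `𝒮'(ℝ³)` with all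
moments and exponential moments (⇒ moment determinacy), whose moment densities are `S`, with translation-invariant
and scale-covariant LAW (`Φ ↦ s^{Δ}Φ(s·)` preserves `μ`). VERBATIM the first six clauses of the conclusion of item
stmt-CriticalPhenomena-11245 `MarkovRigidity.FieldRealisation` (so that its output destructures into this). A
DEFINITION (bundle of hypotheses), not a named fact. [cite: GlimmJaffe1987, §6.1] -/
@[cite "GlimmJaffe1987" "§6.1 (Euclidean fields as laws on 𝒮' with moment densities)"]
def IsMomentFieldOf (Δ : ℝ) (S : CorrFamily 3) (μ : MeasureTheory.Measure Cfg) : Prop :=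
  MeasureTheory.IsProbabilityMeasure μ ∧ Literature.MathematicalPhysics.QuantumLattice.HasAllMoments μ ∧
  (∀ f : SchwartzMap (EuclideanSpace ℝ (Fin 3)) ℝ, MeasureTheory.Integrable
    (fun ω : Literature.MathematicalPhysics.QuantumLattice.FieldConfig (EuclideanSpace ℝ (Fin 3)) => Real.exp (ω f)) μ) ∧
  (∀ (n : ℕ) (f : Fin n → SchwartzMap (EuclideanSpace ℝ (Fin 3)) ℝ),
    Literature.MathematicalPhysics.QuantumLattice.moment μ n f =
      ∫ x : Fin n → EuclideanSpace ℝ (Fin 3), S n x * ∏ i, f i (x i)) ∧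
  Literature.MathematicalPhysics.QuantumLattice.IsTranslationInvariantLaw μ ∧
  (∀ (s : ℝ) (hs : 0 < s), MeasureTheory.Measure.map (Literature.MathematicalPhysics.QuantumLattice.FieldConfig.act
    ((s ^ (Δ - 3 : ℝ)) • Literature.MathematicalPhysics.QuantumLattice.dilateTest s hs.ne')) μ = μ)

/-- `μ` is GERM-MARKOV across every sphere and every plane (McKean): for every open ball or open half-space `U`,
bounded functionals of the inner germ field are conditionally independent of the outer germ field given the germ
at `∂U`. VERBATIM the conclusion of item stmt-CriticalPhenomena-11236 `MarkovRigidity.MarkovInheritance`. A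
DEFINITION (McKean's germ-Markov property), not a named fact. [cite: McKean1963, §1] -/
@[cite "McKean1963" "§1 (germ Markov property across spheres)"]
def IsGermMarkov (μ : MeasureTheory.Measure Cfg) : Prop :=
  ∀ (sig : Set (EuclideanSpace ℝ (Fin 3)) →
      MeasurableSpace (Literature.MathematicalPhysics.QuantumLattice.FieldConfig (EuclideanSpace ℝ (Fin 3)))),
    (sig = fun A => ⨆ (f : SchwartzMap (EuclideanSpace ℝ (Fin 3)) ℝ) (_ : tsupport ⇑f ⊆ A),
      MeasurableSpace.comap (fun ω : Literature.MathematicalPhysics.QuantumLattice.FieldConfig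
        (EuclideanSpace ℝ (Fin 3)) => ω f) (borel ℝ)) →
    ∀ (U : Set (EuclideanSpace ℝ (Fin 3))), ((∃ (c : EuclideanSpace ℝ (Fin 3)) (r : ℝ), U = Metric.ball c r) ∨
      (∃ (v : EuclideanSpace ℝ (Fin 3)) (a : ℝ), v ≠ 0 ∧ U = {x | a < inner ℝ x v})) →
    ∀ (F : Literature.MathematicalPhysics.QuantumLattice.FieldConfig (EuclideanSpace ℝ (Fin 3)) → ℝ),
      @Measurable _ _ (⨅ (ε : ℝ) (_ : 0 < ε), sig (Metric.thickening ε U)) _ F → (∃ C : ℝ, ∀ ω, |F ω| ≤ C) →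
      MeasureTheory.condExp ((⨅ (ε : ℝ) (_ : 0 < ε), sig (Metric.thickening ε Uᶜ)) ⊔
        ⨅ (ε : ℝ) (_ : 0 < ε), sig (Metric.thickening ε (frontier U))) μ F =ᵐ[μ]
      MeasureTheory.condExp (⨅ (ε : ℝ) (_ : 0 < ε), sig (Metric.thickening ε (frontier U))) μ F

/-! ## Proved glue (no `sorry`) -/

/-- **P3 of the card, PROVED** (two-point identification; triage r1-2 `twoPointIdentification`). Under the two-point
law with witness `(Δ, c)`, every non-degenerate pointwise scaling limit `(ρ, S)` of `criticalCorr 3` has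
`S₂(a,b) = c'‖a − b‖^{-2Δ}` with the SAME `Δ` and `c' = S₂(0,e₁) > 0`: along the full filter
`ρ(δ)²δ^{2Δ} → S₂(0,e₁)/c` (`Negative.tendsto_rho_sq_mul_rpow`) while the canonically renormalised pair correlator
tends to `c‖a−b‖^{-2Δ}` (`Negative.tendstoLocallyUniformlyOn_arity_two_of_twoPointLaw`). This is the base case
`E_{1,1}` of the hierarchy (with `Negative.twoPoint_exchange_of_twoPointLaw`) and pins the Weyl weight of the chain. -/
theorem twoPoint_of_limit {Δ c : ℝ} (hc : 0 < c)
    (hP : Tendsto (fun x : Site 3 =>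
      criticalTwoPoint 3 x * Real.sqrt (∑ i, ((x i : ℝ)) ^ 2) ^ (2 * Δ)) cofinite (nhds c))
    {ρ : ℝ → ℝ} {S : CorrFamily 3} (hρ : ∀ δ ∈ Set.Ioc (0 : ℝ) 1, 0 < ρ δ)
    (hlim : HasPointwiseScalingLimit (criticalCorr 3) ρ S) (hnd : IsNondegenerateTwoPoint S) :
    ∃ c' : ℝ, 0 < c' ∧ ∀ a b : E3, a ≠ b → S 2 ![a, b] = c' * ‖a - b‖ ^ (-(2 * Δ)) := by
  set s₁ : ℝ := S 2 ![0, EuclideanSpace.single (0 : Fin 3) (1 : ℝ)] with hs₁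
  have hs₁pos : 0 < s₁ := hnd _ (zero_unitVec_mem_nonCoincident one_ne_zero)
  refine ⟨s₁, hs₁pos, fun a b hab => ?_⟩
  have hx : (![a, b] : Fin 2 → E3) ∈ NonCoincident 3 2 := by
    rw [mem_nonCoincident, injective_fin_two_iff]
    simpa using hab
  -- the limit in the renormalisation `ρ`
  have h1 : Tendsto (fun δ => rescaledCorrelator (criticalCorr 3) ρ 2 δ ![a, b]) (𝓝[>] 0)
      (𝓝 (S 2 ![a, b])) := (hlim 2).tendsto_at hx
  -- the canonical limit (arity two is settled by `P`)
  have h2 : Tendsto (fun δ => rescaledCorrelator (criticalCorr 3) (fun δ => δ ^ (-Δ)) 2 δ ![a, b]) (𝓝[>] 0)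
      (𝓝 (c * twoPt Δ a b)) := by
    have h := (tendstoLocallyUniformlyOn_arity_two_of_twoPointLaw hc hP).tendsto_at hx
    simpa using h
  -- the ratio of the two renormalisations, squared
  have h3 : Tendsto (fun δ : ℝ => ρ δ ^ 2 * δ ^ (2 * Δ)) (𝓝[>] (0 : ℝ)) (𝓝 (s₁ / c)) :=
    tendsto_rho_sq_mul_rpow hc hP hlim
  have h4 : Tendsto (fun δ => rescaledCorrelator (criticalCorr 3) ρ 2 δ ![a, b]) (𝓝[>] 0)
      (𝓝 (s₁ / c * (c * twoPt Δ a b))) := by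
    refine (h3.mul h2).congr' ?_
    filter_upwards [self_mem_nhdsWithin] with δ hδ
    rw [Set.mem_Ioi] at hδ
    have hcan : (δ : ℝ) ^ (-Δ) ≠ 0 := (Real.rpow_pos_of_pos hδ _).ne'
    have e : (ρ δ / δ ^ (-Δ)) ^ 2 = ρ δ ^ 2 * δ ^ (2 * Δ) := by
      rw [div_pow, Real.rpow_neg hδ.le, inv_pow, div_inv_eq_mul, ← Real.rpow_mul_natCast hδ.le,
        show Δ * ((2 : ℕ) : ℝ) = 2 * Δ by push_cast; ring]
    rw [rescaledCorrelator_change (criticalCorr 3) (ρ := fun δ => δ ^ (-Δ)) (ρ' := ρ) 2 hcan, e]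
  have heq := tendsto_nhds_unique h1 h4
  rw [heq, twoPt]
  field_simp

/-- **Dilations are free, PROVED** (Disproof `crux_iff_even_sharp` in this line's clothing): under the two-point law,
every normalised non-degenerate pointwise limit `(ρ, S)` is scale covariant with the two-point exponent `Δ` — `S` is
`μ^{-n}` times the CANONICAL limit (`Negative.hasPointwiseScalingLimit_of_ratio_tendsto` + `tendsto_canonical_ratio`),
which is scale covariant by the exact mesh identity `[cx/δ] = [x/(δ/c)]` (`Negative.scaleCovariant_of_canonical_limit`).
So the sphere chain of the line is STATIONARY without assumption. -/
theorem isScaleCovariant_of_limit {Δ c : ℝ} (hc : 0 < c)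
    (hP : Tendsto (fun x : Site 3 =>
      criticalTwoPoint 3 x * Real.sqrt (∑ i, ((x i : ℝ)) ^ 2) ^ (2 * Δ)) cofinite (nhds c))
    {ρ : ℝ → ℝ} {S : CorrFamily 3} (hρ : ∀ δ ∈ Set.Ioc (0 : ℝ) 1, 0 < ρ δ)
    (hlim : HasPointwiseScalingLimit (criticalCorr 3) ρ S) (hnd : IsNondegenerateTwoPoint S)
    (hnorm : ∀ n z, z ∉ NonCoincident 3 n → S n z = 0) :
    IsScaleCovariant Δ S := by
  set μ : ℝ := Real.sqrt (c / S 2 ![0, EuclideanSpace.single (0 : Fin 3) (1 : ℝ)]) with hμ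
  have hs : 0 < S 2 ![0, EuclideanSpace.single (0 : Fin 3) (1 : ℝ)] :=
    hnd _ (zero_unitVec_mem_nonCoincident one_ne_zero)
  have hμpos : 0 < μ := Real.sqrt_pos.2 (div_pos hc hs)
  have hcan : HasPointwiseScalingLimit (criticalCorr 3) (fun δ => δ ^ (-Δ)) (fun n x => μ ^ n * S n x) :=
    hasPointwiseScalingLimit_of_ratio_tendsto hlim (fun δ hδ => (hρ δ hδ).ne')
      (tendsto_canonical_ratio hc hP hρ hlim hnd)
  intro n k hk x
  by_cases hx : x ∈ NonCoincident 3 n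
  · have key := scaleCovariant_of_canonical_limit (G := criticalCorr 3) (Δ := Δ)
      (T := fun y : Fin n → E3 => μ ^ n * S n y) (fun y hy => (hcan n).tendsto_at hy) hk hx
    have hμn : μ ^ n ≠ 0 := pow_ne_zero _ hμpos.ne'
    apply mul_left_cancel₀ hμn
    rw [key]
    ring
  · have hx' : (fun i => k • x i) ∉ NonCoincident 3 n := by
      intro h
      apply hx
      rw [mem_nonCoincident] at h ⊢
      intro i j hij
      exact h (show k • x i = k • x j by rw [hij])
    rw [hnorm n _ hx', hnorm n x hx, mul_zero]

/-- The unit inversion is the member `λ = 1` of the sphere-inversion family: `S ∈ sphereInversionCovariant Δ`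
gives the tree predicate `IsInversionCovariant Δ S` (inversion OFF the origin only, as the tree types it). -/
theorem isInversionCovariant_of_mem {Δ : ℝ} {S : CorrFamily 3} (h : S ∈ sphereInversionCovariant Δ) :
    IsInversionCovariant Δ S := by
  simp only [sphereInversionCovariant, Set.mem_setOf_eq] at h
  intro n x hx
  have key := h n 1 one_pos x hx
  have e : (fun i => (1 / ‖x i‖ ^ 2) • x i) = fun i => EuclideanGeometry.inversion 0 1 (x i) := by
    funext i
    rw [sphereInversion_eq_smul_inversion, one_smul]
  rw [e, Real.one_rpow, one_mul] at key
  exact key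

/-- NECESSITY of K1 (no stub stronger than the target): a Möbius-covariant family satisfies the whole exchange
hierarchy (landed A1 + A2 of the card). Hence, under `P`, the conclusion `Q` of the crux implies the conclusion of
`stub_twoTimeSymmetry` for every regular limit (all of them being `κⁿ`-multiples of the Möbius one,
`tendsto_rescaledCorrelator_unique_upToScalar`). -/
theorem twoShellExchange_of_moebius {Δ : ℝ} {S : CorrFamily 3} (h : IsMoebiusCovariant Δ S) :
    S ∈ twoShellExchange Δ :=
  mem_twoShellExchange_of_mem_sphereInversionCovariant
    (mem_sphereInversionCovariant_of_scale_of_inversion h.2.1 h.2.2)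

/-! ## Registered stubs -/

/-- **Stub K1 — two-time symmetry of the sphere chain (open; HARDEST; the interface every reversibility engine
must reach).** Under the two-point law `(Δ, c)`: every pointwise scaling limit `S` of the critical `ℤ³` correlators
that is normalised off `NonCoincident`, translation invariant, continuous off the diagonals, scale covariant with
the two-point exponent `Δ` and has `S₂ = c'‖a−b‖^{-2Δ}` (all supplied by item 5355 + the proved glue above) obeys
the TWO-SHELL EXCHANGE HIERARCHY `E_{k,m}`: for unit directions `u_i`, a marking of inner/outer points and radii
`0 < a, b`, swapping the radii of the two angular patterns multiplies `S_n` by `(a/b)^{(k−m)Δ}`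
(`S ∈ Negative.twoShellExchange Δ`). Reading (the lever's input): the Weyl-rescaled traces `a^Δ Φ|_{S_a}`,
`b^Δ Φ|_{S_b}` of the limit field are EXCHANGEABLE in law — all mixed moments on `S_a ∪ S_b` are swap-symmetric —
i.e. the two-time law of the stationary chain `t ↦ e^{Δt} Φ|_{S_{e^t}}` is symmetric; about every centre by
translation invariance. Why plausibly true: it is a NECESSARY consequence of `Q` (`twoShellExchange_of_moebius`),
its `(1,1)` member IS the hypothesis (`Negative.twoPoint_exchange_of_twoPointLaw`), `(k,0)/(0,m)` and `a = b` are
identities, coincidences are swap-stable (both sides `0`); the first open member `E_{2,2}` is weight-free and, for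
axis patterns and integer radii, an exact identity between two honest `ℤ³` four-point functions at every scale
(MC test j006843, Disproof §4), violated by the catalogued non-Möbius witness `ScaleNotMoebius.narrowFamily`
exactly at unequal opening angles — so the statement is outside the model-blind class and uses `criticalCorr 3`.
What it decides arity by arity (Disproof §3c, `output_rank_n4.txt`): at `n = 4`, `E_{2,2}` about all centres +
similarities + continuity ⇒ inversion covariance of `S₄` (no Markov input); at generic `n ≥ 6` configurations it is
silent (K2 carries them). Why it might fail / size: it is conformal covariance restricted to two-sphere
configurations — false iff the `ℤ³` limit is scale- but not Möbius-covariant (a `Δ_V = 2` virial current, excluded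
only numerically, `Δ_V > 5`); no engine of its own on this line (candidate engines: the annulus line's LKS + RGU +
landed `Negative/ReversalPrinciple`, or sphere-RP item 4671); open-problem-sized. [DuminilCopinICM2022 §8.4;
Nakayama2015 §2.4.3; MenesesEtAl2019; DelamotteTissierWschebor2016]
LEAD STATUS (cycle 1): FREE MEMBERS PROVED — registered sub-goal `stub_twoTimeSymmetry_free` (odd `n`, `n ≤ 2`,
one-shell markings; file `Theorems/PrecisionLaplacianMoebiusLimitOfTwoPointLawTwoShellFree.lean`, p89752) with the
kernel-checked reduction `mem_twoShellExchange_iff_core`: this stub ⇔ `E_{k,m}` for `k, m ≥ 1`, `k + m` even `≥ 4`.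
STUCK exactly there (no engine on this line; = clause (c) on two-sphere configurations). -/
theorem stub_twoTimeSymmetry :
    ∀ (Δ c : ℝ), 0 < c →
      Tendsto (fun x : Site 3 =>
        criticalTwoPoint 3 x * Real.sqrt (∑ i, ((x i : ℝ)) ^ 2) ^ (2 * Δ)) cofinite (nhds c) →
    ∀ (ρ : ℝ → ℝ) (S : CorrFamily 3), (∀ δ ∈ Set.Ioc (0 : ℝ) 1, 0 < ρ δ) →
      HasPointwiseScalingLimit (criticalCorr 3) ρ S →
      (∀ n z, z ∉ NonCoincident 3 n → S n z = 0) →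
      IsTranslationInvariant S → (∀ n, ContinuousOn (S n) (NonCoincident 3 n)) →
      IsScaleCovariant Δ S →
      (∃ c' : ℝ, 0 < c' ∧ ∀ a b : E3, a ≠ b → S 2 ![a, b] = c' * ‖a - b‖ ^ (-(2 * Δ))) →
      S ∈ twoShellExchange Δ := by
  sorry

/-- **Stub K2a — law-level reversal of the sphere chain (OPEN core of K2; lead reshape, cycle 2).** Same `S`, `μ`
as K2. Claim: the LAW of the Weyl-rescaled limit field is invariant under every origin-centred sphere inversion
`ι_λ : x ↦ λx/‖x‖²`, tested on moments against smooth test functions compactly supported off the origin with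
pairwise disjoint supports: with the moment densities `S` of `μ` (clause `hdens` of `IsMomentFieldOf`) this is the
identity `∫ S_n(x) ∏ᵢ (λ/‖xᵢ‖²)^{3−Δ} fᵢ(ι_λ xᵢ) dx = ∫ S_n(x) ∏ᵢ fᵢ(xᵢ) dx` (test functions transform as densities
of weight `3 − Δ`, Di Francesco–Mathieu–Sénéchal 1997 (4.32); `(λ/‖x‖²)` is the conformal factor of `ι_λ`). This is
"stationary + germ-Markov + symmetric two-time law ⇒ reversible" for the chain `t ↦ e^{Δt}Φ|_{S_{e^t}}`, in law
form; it is where the Markov structure (`IsGermMarkov μ`) must act and where a law-level ENGINE (annulus-kelvin LKS +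
RGU, sphere-RP items 4671/4674, Nelson–Polyakov rigidity 11243) would plug in. Open core (i)–(iii) of K2 unchanged:
σ(trace_r) = germ(S_r) mod μ, generation by sphere germs, determinacy. [Kelly1979 ch. 1; Nelson1973; GlimmJaffe1987
§6.1; FrancescoMathieuSenechal1997 §4.2.1 (4.32)] -/
theorem stub_lawReversal :
    ∀ (Δ c : ℝ), 0 < c →
      Tendsto (fun x : Site 3 =>
        criticalTwoPoint 3 x * Real.sqrt (∑ i, ((x i : ℝ)) ^ 2) ^ (2 * Δ)) cofinite (nhds c) →
    ∀ (ρ : ℝ → ℝ) (S : CorrFamily 3) (μ : MeasureTheory.Measure Cfg), (∀ δ ∈ Set.Ioc (0 : ℝ) 1, 0 < ρ δ) →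
      HasPointwiseScalingLimit (criticalCorr 3) ρ S →
      (∀ n z, z ∉ NonCoincident 3 n → S n z = 0) →
      IsTranslationInvariant S → (∀ n, ContinuousOn (S n) (NonCoincident 3 n)) →
      IsScaleCovariant Δ S →
      (∃ c' : ℝ, 0 < c' ∧ ∀ a b : E3, a ≠ b → S 2 ![a, b] = c' * ‖a - b‖ ^ (-(2 * Δ))) →
      IsMomentFieldOf Δ S μ → IsGermMarkov μ →
      S ∈ twoShellExchange Δ →
      ∀ (n : ℕ) (lam : ℝ), 0 < lam → ∀ (f : Fin n → EuclideanSpace ℝ (Fin 3) → ℝ),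
        (∀ i, ContDiff ℝ ((⊤ : ℕ∞) : WithTop ℕ∞) (f i) ∧ HasCompactSupport (f i) ∧ tsupport (f i) ⊆ {0}ᶜ) →
        (∀ i j, i ≠ j → Disjoint (tsupport (f i)) (tsupport (f j))) →
        (∫ x : Fin n → EuclideanSpace ℝ (Fin 3),
            S n x * ∏ i, ((lam / ‖x i‖ ^ 2) ^ ((3 : ℝ) - Δ) * f i ((lam / ‖x i‖ ^ 2) • x i))) =
          ∫ x : Fin n → EuclideanSpace ℝ (Fin 3), S n x * ∏ i, f i (x i) := by
  sorry

/-- **Stub K2b — densities of a reversible law are sphere-inversion covariant (provable now; lead reshape,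
cycle 2).** Pure analysis on `CorrFamily 3`, no probability: if `S` is continuous on `NonCoincident` and `0` off it,
and the smeared identity of K2a holds for all smooth test functions compactly supported off the origin with pairwise
disjoint supports, then `S ∈ sphereInversionCovariant Δ` pointwise. Route: change variables `y = ι_λ x` coordinatewise
on `({0}ᶜ)ⁿ` (`MeasureTheory.integral_image_eq_integral_abs_det_fderiv_smul` with `ContinuousLinearMap.det_pi`,
`EuclideanGeometry.hasFDerivAt_inversion`, `Submodule.det_reflection`; `|det Dι_λ(x)| = (λ/‖x‖²)³`), so that the
identity reads `∫ H(x) ∏ gᵢ(xᵢ) dx = 0` for all admissible `g` with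
`H(x) = (λ/‖·‖²)³-weighted S_n(ι_λ x) − (λ/‖·‖²)^{3−Δ}-weighted S_n(x)`, continuous near every non-coincident
off-origin configuration; product bump functions (`ContDiffBump`) with shrinking radii then give `H = 0` there, i.e.
`S_n(ι_λ x) = λ^{−nΔ} ∏‖xᵢ‖^{2Δ} S_n(x)`; off `NonCoincident` both sides vanish (`ι_λ` is injective). The line's K2 is
K2b ∘ K2a. [FrancescoMathieuSenechal1997 §4.3.1 (4.48); HormanderALPDO1 Thm 1.2.5 (fundamental lemma)]
LEAD STATUS (cycle 2): CLOSED — proved by worker aa92dbb9…: helper `integral_sphereInversion_transfer` (p91630,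
`Theorems/PrecisionLaplacianMoebiusLimitOfTwoPointLawSphereInversionCoV.lean`) and the stub itself (p92499 ACCEPTED,
`Theorems/PrecisionLaplacianMoebiusLimitOfTwoPointLawDensityOfLawReversal.lean`). Final assembly (p92535,
`…AssemblyLaw.lean`): 4801 ⇐ item 5355 ∧ [K2a's conclusion for every regular limit]. -/
theorem stub_densityOfLawReversal :
    ∀ (Δ : ℝ) (S : CorrFamily 3), (∀ n, ContinuousOn (S n) (NonCoincident 3 n)) →
      (∀ n z, z ∉ NonCoincident 3 n → S n z = 0) →
      (∀ (n : ℕ) (lam : ℝ), 0 < lam → ∀ (f : Fin n → EuclideanSpace ℝ (Fin 3) → ℝ),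
        (∀ i, ContDiff ℝ ((⊤ : ℕ∞) : WithTop ℕ∞) (f i) ∧ HasCompactSupport (f i) ∧ tsupport (f i) ⊆ {0}ᶜ) →
        (∀ i j, i ≠ j → Disjoint (tsupport (f i)) (tsupport (f j))) →
        (∫ x : Fin n → EuclideanSpace ℝ (Fin 3),
            S n x * ∏ i, ((lam / ‖x i‖ ^ 2) ^ ((3 : ℝ) - Δ) * f i ((lam / ‖x i‖ ^ 2) • x i))) =
          ∫ x : Fin n → EuclideanSpace ℝ (Fin 3), S n x * ∏ i, f i (x i)) →
      S ∈ sphereInversionCovariant Δ :=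
  -- CLOSED (wave 2, p92499; helper p91630): `Theorems/PrecisionLaplacianMoebiusLimitOfTwoPointLawDensityOfLawReversal.lean`
  PrecisionLaplacianMoebiusLimitOfTwoPointLaw.stub_densityOfLawReversal

/-- **Stub K2 — trace reversibility of the germ-Markov limit field (open; the LEVER).** Same limit `S` as in K1,
now with its LAW: `μ` a moment field of `S` with dimension `Δ` (all moments + exponential moments ⇒ determinacy;
translation-invariant and scale-covariant law — item 11245) which is germ-Markov across every sphere (item 11236,
McKean germ σ-algebras of the observed field ITSELF). Claim: if the trace moments are two-time symmetric
(`S ∈ twoShellExchange Δ`), then `S` is covariant under EVERY origin-centred sphere inversion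
`ι_λ : x ↦ λx/‖x‖²` with weight `Δ` (`S ∈ Negative.sphereInversionCovariant Δ`). Mechanism ("zooming out is the
time reversal of zooming in"): the Weyl dilations `D_s` preserve `μ` and carry the germ σ-algebra of `S_r` to that of
`S_{sr}`, so `t ↦ germ(S_{e^t})` is a STATIONARY process, MARKOV by 11236 (inside ⟂ outside | germ of the sphere);
reversal `t ↦ −t` composed with the shift IS `ι_λ` (directions fixed, radii `a ↦ λ/a`, weight `(λ/‖x‖²)^Δ`); a
stationary Markov process whose two-time law is symmetric is REVERSIBLE (transition operator self-adjoint on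
`L²(π)`; `P_{s+t} = P_s P_t` propagates self-adjointness from small times; finite-state shadow landed:
`Negative/ReversalPrinciple`), hence `μ ∘ ι_λ⁻¹ = μ` on the σ-algebra generated by the sphere germs, and the moment
densities inherit `ι_λ`-covariance at ALL configurations off the origin (not only two-shell ones) — this is what
carries the generic `n ≥ 6` configurations on which the hierarchy itself is silent (Disproof §3c). The honest open
core (why it might fail): (i) TRACE vs GERM — two-time symmetry is fed in through moments of the sphere TRACES
(points ON `S_a ∪ S_b`), while the Markov state is the GERM; the lift needs `σ(trace) = germ` mod `μ`-null sets
(true for the 3D GFF: single layers are the only `H^{-1}` distributions carried by a sphere; for the interacting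
limit an `ε`-sector boundary datum would break it and force the enlarged "jet" hierarchy), traces being honest
`L²` fields on `S²` because `2Δ < 2` (`Δ ≤ 3/4`, `dcp_isingEta_le_half_holds`; `Δ = 1` edge of `exponent_window` not
covered by traces); (ii) the sphere germs must GENERATE the field σ-algebra mod `μ` (white noise shows germs can be
trivial; here `r ↦ trace_r(g)` is `L²`-continuous and `ω(f) = ∫ trace_r(f|_{S_r}) r² dr`); (iii) moment identities
⇒ equality of laws by determinacy (exponential moments, Newman's Lee–Yang bounds). Size: L/XL; theorem-shaped
modulo (i). [Nelson1973; GlimmJaffe1987 §6.1; Rockner1986; Kelly1979 ch. 1; KyprianouPardo2022 chs. 12–13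
(inversion ↔ time reversal for self-similar Markov processes); card markov-rigidity-locality-sigma-algebra]
LEAD STATUS (cycle 1): worker verdict `stub-blocked: none` — the ≥ 3-radii configurations are unreachable: the
hypotheses speak of `μ` through Schwartz tests and germ σ-algebras, the conclusion of pointwise densities on
spheres, and the tree has no trace/restriction theory of field laws on spheres, no radial disintegration, no
condExp → moment-density lemma (`IsGermMarkov μ` is tree-idle). FREE PART PROVED — registered sub-goal
`stub_traceReversibility_free` (odd `n`; two-shell configurations ⇐ `twoShellExchange` + scale covariance; file
`Theorems/PrecisionLaplacianMoebiusLimitOfTwoPointLawSphereInversionFree.lean`, p89807) with the reduction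
`mem_sphereInversionCovariant_iff_core`: this stub ⇔ the `ι_λ`-identity at even `n ≥ 4` on configurations with
≥ 3 distinct radii. Honest restatement for a future line: K2a (OPEN, law-level `ι_λ`-invariance of the moment field:
`∫ S n x ∏((λ/‖x_i‖²)^{3−Δ} f_i(ι_λ x_i)) = ∫ S n x ∏ f_i(x_i)` for `f_i ∈ C_c^∞({0}ᶜ)`) ∘ K2b (provable now: that
identity + continuity + normalisation ⇒ `S ∈ sphereInversionCovariant Δ`, n-fold change of variables). -/
theorem stub_traceReversibility :
    ∀ (Δ c : ℝ), 0 < c →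
      Tendsto (fun x : Site 3 =>
        criticalTwoPoint 3 x * Real.sqrt (∑ i, ((x i : ℝ)) ^ 2) ^ (2 * Δ)) cofinite (nhds c) →
    ∀ (ρ : ℝ → ℝ) (S : CorrFamily 3) (μ : MeasureTheory.Measure Cfg), (∀ δ ∈ Set.Ioc (0 : ℝ) 1, 0 < ρ δ) →
      HasPointwiseScalingLimit (criticalCorr 3) ρ S →
      (∀ n z, z ∉ NonCoincident 3 n → S n z = 0) →
      IsTranslationInvariant S → (∀ n, ContinuousOn (S n) (NonCoincident 3 n)) →
      IsScaleCovariant Δ S →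
      (∃ c' : ℝ, 0 < c' ∧ ∀ a b : E3, a ≠ b → S 2 ![a, b] = c' * ‖a - b‖ ^ (-(2 * Δ))) →
      IsMomentFieldOf Δ S μ → IsGermMarkov μ →
      S ∈ twoShellExchange Δ → S ∈ sphereInversionCovariant Δ :=
  -- LEAD RESHAPE (cycle 2): K2 = K2b ∘ K2a (law-level reversal, open) (density lemma, provable now)
  fun Δ c hc hP ρ S μ hρ hlim hnorm htr hcont hsc h2pt hMF hGM hex =>
    stub_densityOfLawReversal Δ S hcont hnorm
      (stub_lawReversal Δ c hc hP ρ S μ hρ hlim hnorm htr hcont hsc h2pt hMF hGM hex)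

/-- **Stub A0 — the group lemma, = item stmt-CriticalPhenomena-4675
`PositivityBegetsConformality.InversionBegetsRotations` BY NAME (provable now; internalised by the lead so that
obligation (b) `O(3)` of `crux_iff_even_sharper` is discharged INSIDE the line instead of imported).** For every
`Δ` and every `S : CorrFamily 3`: translation invariance + covariance under the unit inversion (off the origin)
⇒ invariance under every linear isometry of `ℝ³` (all of `O(3)`), with no continuity, scale covariance or
normalisation. Proof route (item docstring): for a unit vector `a`, the reflection in the affine plane
`{y | ⟪y,a⟫ = 1/2}` equals `ι ∘ τ_a ∘ ι ∘ τ_{−a} ∘ ι` pointwise off the poles `{0, a}` (the unit inversion maps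
the unit sphere about `a`, which passes through `0`, to that plane; conjugating an inversion by `ι` gives the
inversion in the image), and the three inversion weights multiply to `1` (`‖w‖·‖z − a‖·‖y‖ = 1` with
`z = ι y`, `w = a + (z−a)/‖z−a‖²`, since `‖w‖ = ‖z‖/‖z−a‖`); a configuration is first translated off the
finitely many pole positions (translation invariance, `S n (R(x+u)) = S n (R x + R u) = S n (R x)`), so the
identity holds at EVERY configuration; reflections in planes through `0` differ from these by a translation;
`O(3)` is generated by such reflections (`LinearIsometryEquiv.reflections_generate`, Cartan–Dieudonné).
Translation invariance is load-bearing (`Negative.not_groupLemma_without_translation`).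
[FrancescoMathieuSenechal1997 §4.1; BenedettiPetronio1992 ch. A] -/
theorem stub_inversionBegetsRotations :
    Theses.PositivityBegetsConformality.InversionBegetsRotations :=
  -- CLOSED (wave 1, p86170): `Theorems/PrecisionLaplacianMoebiusLimitOfTwoPointLawInversionBegetsRotations.lean`
  PrecisionLaplacianMoebiusLimitOfTwoPointLaw.stub_inversionBegetsRotations

/-- **Stub L — law-level sphere-inversion reversibility of regular limits (OPEN; the line's target at the level where
ANY engine plugs in; lead final reshape, cycle 3 — the statement the lead asks the planners to PROMOTE).** Under the
two-point law with witness `(Δ, c)`: for every regular pointwise limit `S` of `criticalCorr 3` (normalised off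
`NonCoincident`, translation invariant, continuous off the diagonals, scale covariant with the two-point `Δ`,
`S₂ = c'‖·‖^{-2Δ}`), the smeared `ι_λ`-reversal identity holds:
`∫ S_n(x) ∏ᵢ (λ/‖xᵢ‖²)^{3−Δ} fᵢ(ι_λ xᵢ) dx = ∫ S_n(x) ∏ᵢ fᵢ(xᵢ) dx` for all `λ > 0` and all smooth `fᵢ` compactly supported off
the origin with pairwise disjoint supports (test functions transform as densities of weight `3 − Δ`; this is
"the LAW of the Weyl-rescaled limit field is invariant under the origin-centred sphere inversions", i.e. the sphere
chain `t ↦ e^{Δt}Φ|_{S_{e^t}}` is reversible). Engine-agnostic: NO Markov / moment-field / two-time-symmetry hypothesis.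
How the line's other pieces relate to it: the card's Markov mechanism is the (dead here) decomposition
L ⇐ K1 (`stub_twoTimeSymmetry`, two-time symmetry, no engine) + items 11245/11236 + K2a (`stub_lawReversal`, the
reversal principle, infrastructure-blocked); the tree-vocabulary form of L's hypothesis-to-be for law-level engines is
`lawReversal_of_moment_invariance` (`…LawBridge.lean`, p93452: moment invariance of `μ` under
`moebiusWeightedAction (ι.trans (dilation λ)) Δ` ⇒ this identity); downstream, L ⇒ `S ∈ sphereInversionCovariant Δ`
(K2b `stub_densityOfLawReversal`, p92499) ⇒ Möbius ⇒ crux (`stub_moebiusOfReversibleLimits`, p89802; assembled as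
`moebiusLimitOfTwoPointLaw_of_existsRegularLimit_of_lawReversal`, `…AssemblyLaw.lean`). Size: crux-sized — by
`moebiusLimitOfTwoPointLaw_iff_existence_and_inversion` (p89954) it is clause (c) of the crux for regular limits, in law
form; candidate engines: annulus-kelvin (LKS + RGU + `Negative/ReversalPrinciple`), sphere-RP
(`PositivityBegetsConformality` items 4671 + 4674), Nelson–Polyakov rigidity (11243); falsifier: E_{2,2} at `n = 4` on the
lattice (j006843). [FrancescoMathieuSenechal1997 §4.2.1 (4.32), §4.3.1 (4.48); Kelly1979 ch. 1; DuminilCopinICM2022 §8.4] -/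
theorem stub_lawLevelReversal :
    ∀ (Δ c : ℝ), 0 < c →
      Tendsto (fun x : Site 3 =>
        criticalTwoPoint 3 x * Real.sqrt (∑ i, ((x i : ℝ)) ^ 2) ^ (2 * Δ)) cofinite (nhds c) →
      ∀ (ρ : ℝ → ℝ) (S : CorrFamily 3), (∀ δ ∈ Set.Ioc (0 : ℝ) 1, 0 < ρ δ) →
        HasPointwiseScalingLimit (criticalCorr 3) ρ S →
        (∀ n z, z ∉ NonCoincident 3 n → S n z = 0) →
        IsTranslationInvariant S → (∀ n, ContinuousOn (S n) (NonCoincident 3 n)) →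
        IsScaleCovariant Δ S →
        (∃ c' : ℝ, 0 < c' ∧ ∀ a b : EuclideanSpace ℝ (Fin 3), a ≠ b → S 2 ![a, b] = c' * ‖a - b‖ ^ (-(2 * Δ))) →
        ∀ (n : ℕ) (lam : ℝ), 0 < lam → ∀ (f : Fin n → EuclideanSpace ℝ (Fin 3) → ℝ),
          (∀ i, ContDiff ℝ ((⊤ : ℕ∞) : WithTop ℕ∞) (f i) ∧ HasCompactSupport (f i) ∧ tsupport (f i) ⊆ {0}ᶜ) →
          (∀ i j, i ≠ j → Disjoint (tsupport (f i)) (tsupport (f j))) →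
          (∫ x : Fin n → EuclideanSpace ℝ (Fin 3),
              S n x * ∏ i, ((lam / ‖x i‖ ^ 2) ^ ((3 : ℝ) - Δ) * f i ((lam / ‖x i‖ ^ 2) • x i))) =
            ∫ x : Fin n → EuclideanSpace ℝ (Fin 3), S n x * ∏ i, f i (x i) := by
  sorry

/-! ## Kernel-checked composition -/

/-- **Sorry-free certificate of the composition.** With the two stub STATEMENTS as hypotheses (verbatim the
signatures of `stub_twoTimeSymmetry`, `stub_traceReversibility`) and the four route items by name, the DEFINIENS of
the crux (spelled out, so that this certificate is not itself a candidate skeleton theorem) follows: pure logic plus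
the proved glue `twoPoint_of_limit`, `isScaleCovariant_of_limit`, `isInversionCovariant_of_mem`. -/
theorem cruxBody_of_statements
    (hE : Theses.PrimaryAtInfinity.ExistsRegularLimit)
    (hR : Theses.PositivityBegetsConformality.InversionBegetsRotations)
    (hF : Theses.MarkovRigidity.FieldRealisation)
    (hM : Theses.MarkovRigidity.MarkovInheritance)
    (h₁ : ∀ (Δ c : ℝ), 0 < c →
      Tendsto (fun x : Site 3 =>
        criticalTwoPoint 3 x * Real.sqrt (∑ i, ((x i : ℝ)) ^ 2) ^ (2 * Δ)) cofinite (nhds c) →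
      ∀ (ρ : ℝ → ℝ) (S : CorrFamily 3), (∀ δ ∈ Set.Ioc (0 : ℝ) 1, 0 < ρ δ) →
        HasPointwiseScalingLimit (criticalCorr 3) ρ S →
        (∀ n z, z ∉ NonCoincident 3 n → S n z = 0) →
        IsTranslationInvariant S → (∀ n, ContinuousOn (S n) (NonCoincident 3 n)) →
        IsScaleCovariant Δ S →
        (∃ c' : ℝ, 0 < c' ∧ ∀ a b : E3, a ≠ b → S 2 ![a, b] = c' * ‖a - b‖ ^ (-(2 * Δ))) →
        S ∈ twoShellExchange Δ)
    (h₂ : ∀ (Δ c : ℝ), 0 < c →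
      Tendsto (fun x : Site 3 =>
        criticalTwoPoint 3 x * Real.sqrt (∑ i, ((x i : ℝ)) ^ 2) ^ (2 * Δ)) cofinite (nhds c) →
      ∀ (ρ : ℝ → ℝ) (S : CorrFamily 3) (μ : MeasureTheory.Measure Cfg), (∀ δ ∈ Set.Ioc (0 : ℝ) 1, 0 < ρ δ) →
        HasPointwiseScalingLimit (criticalCorr 3) ρ S →
        (∀ n z, z ∉ NonCoincident 3 n → S n z = 0) →
        IsTranslationInvariant S → (∀ n, ContinuousOn (S n) (NonCoincident 3 n)) →
        IsScaleCovariant Δ S →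
        (∃ c' : ℝ, 0 < c' ∧ ∀ a b : E3, a ≠ b → S 2 ![a, b] = c' * ‖a - b‖ ^ (-(2 * Δ))) →
        IsMomentFieldOf Δ S μ → IsGermMarkov μ →
        S ∈ twoShellExchange Δ → S ∈ sphereInversionCovariant Δ) :
    (∃ Δ c : ℝ, 0 < c ∧ Tendsto (fun x : Site 3 =>
        criticalTwoPoint 3 x * Real.sqrt (∑ i, ((x i : ℝ)) ^ 2) ^ (2 * Δ)) cofinite (nhds c)) →
      ∃ (ρ : ℝ → ℝ) (Δ : ℝ) (S : CorrFamily 3), (∀ δ ∈ Set.Ioc (0 : ℝ) 1, 0 < ρ δ) ∧ 0 < Δ ∧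
        HasPointwiseScalingLimit (criticalCorr 3) ρ S ∧ IsNondegenerateTwoPoint S ∧ IsMoebiusCovariant Δ S := by
  rintro ⟨Δ, c, hc, hP⟩
  -- (a) existence: the regular translation-invariant limit of item 5355
  obtain ⟨ρ, S, hρ, hlim, hnorm, hnd, htr, hpar, hcont⟩ := hE
  have hΔ : 0 < Δ := twoPointLaw_exponent_pos hc hP
  -- proved glue: the two-point function and the dilations of `S`
  have h2pt : ∃ c' : ℝ, 0 < c' ∧ ∀ a b : E3, a ≠ b → S 2 ![a, b] = c' * ‖a - b‖ ^ (-(2 * Δ)) :=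
    twoPoint_of_limit hc hP hρ hlim hnd
  have hsc : IsScaleCovariant Δ S := isScaleCovariant_of_limit hc hP hρ hlim hnd hnorm
  -- the field law (item 11245) and its germ-Markov property (item 11236)
  obtain ⟨-, μ, hprob, hmom, hexp, hdens, htrl, hscl, -, -, -⟩ := hF ρ Δ S hρ hlim hnorm hnd htr hsc
  have hmarkov : IsGermMarkov μ := hM ρ Δ S μ hρ hlim hnorm hnd htr hsc hprob hmom hexp hdens
  -- K1: two-time symmetry; K2: reversibility of the sphere chain
  have hex : S ∈ twoShellExchange Δ := h₁ Δ c hc hP ρ S hρ hlim hnorm htr hcont hsc h2pt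
  have hsph : S ∈ sphereInversionCovariant Δ :=
    h₂ Δ c hc hP ρ S μ hρ hlim hnorm htr hcont hsc h2pt ⟨hprob, hmom, hexp, hdens, htrl, hscl⟩ hmarkov hex
  -- kinematics: unit inversion, then rotations from translations + inversion (item 4675)
  have hinv : IsInversionCovariant Δ S := isInversionCovariant_of_mem hsph
  have hrot : IsRotationInvariant S := hR Δ S htr hinv
  exact ⟨ρ, Δ, S, hρ, hΔ, hlim, hnd, ⟨htr, hrot⟩, hsc, hinv⟩

/-- **The line concludes the crux BY NAME (final shape).** Item stmt-CriticalPhenomena-5355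
`PrimaryAtInfinity.ExistsRegularLimit` (existence of a regular translation-invariant limit, BY NAME) and the single
open stub L `stub_lawLevelReversal` give `Theses.PrecisionLaplacian.MoebiusLimitOfTwoPointLaw`: the LANDED density lemma
(K2b, `…DensityOfLawReversal.lean`) turns L into pointwise `ι_λ`-covariance and the LANDED glue
(`stub_moebiusOfReversibleLimits`, `…TwoShellGlue.lean`: dilations free, `ι₁ ∈ {ι_λ}`, `O(3)` from translations + `ι₁`
by the landed group lemma A0) into the crux. The only `sorry` in this closure is L. -/
theorem MoebiusLimitOfTwoPointLaw_of
    (hE : Theses.PrimaryAtInfinity.ExistsRegularLimit) :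
    Theses.PrecisionLaplacian.MoebiusLimitOfTwoPointLaw :=
  PrecisionLaplacianMoebiusLimitOfTwoPointLaw.stub_moebiusOfReversibleLimits hE
    fun Δ c hc hP ρ S hρ hlim hnorm htr hcont hsc h2pt =>
      PrecisionLaplacianMoebiusLimitOfTwoPointLaw.stub_densityOfLawReversal Δ S hcont hnorm
        (stub_lawLevelReversal Δ c hc hP ρ S hρ hlim hnorm htr hcont hsc h2pt)

/-- The same under the second host route's spelling of the crux (`Theses.BernsteinTemperature.MoebiusLimitOfTwoPointLaw`,
item stmt-CriticalPhenomena-4801 as r5 of route BernsteinTemperature; identical definiens). -/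
theorem MoebiusLimitOfTwoPointLaw_of'
    (hE : Theses.PrimaryAtInfinity.ExistsRegularLimit) :
    Theses.BernsteinTemperature.MoebiusLimitOfTwoPointLaw :=
  MoebiusLimitOfTwoPointLaw_of hE

/-- **The card's Markov decomposition (kept for the record; dead on this hub).** Existence (item 5355), the field
realisation (item stmt-CriticalPhenomena-11245 `MarkovRigidity.FieldRealisation`) and germ-Markov inheritance (item
stmt-CriticalPhenomena-11236 `MarkovRigidity.MarkovInheritance`), BY NAME, composed with K1 (`stub_twoTimeSymmetry`,
STUCK at its core), K2 = K2b ∘ K2a (`stub_densityOfLawReversal` CLOSED ∘ `stub_lawReversal` OPEN) and A0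
(`stub_inversionBegetsRotations`, CLOSED) ⇒ the crux; the `sorry`s in this closure are K1 and K2a. -/
theorem MoebiusLimitOfTwoPointLaw_of_markov
    (hE : Theses.PrimaryAtInfinity.ExistsRegularLimit)
    (hF : Theses.MarkovRigidity.FieldRealisation)
    (hM : Theses.MarkovRigidity.MarkovInheritance) :
    Theses.PrecisionLaplacian.MoebiusLimitOfTwoPointLaw :=
  cruxBody_of_statements hE stub_inversionBegetsRotations hF hM stub_twoTimeSymmetry stub_traceReversibility

end Summit.CriticalPhenomena.Ising3DConformalLimit.Cruxes.MoebiusLimitOfTwoPointLaw.TwoShellExchangeMarkov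

end
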